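import Literature.NumberTheory.LFunctions.Zhang2022.Section8FrontEnd44Exact
import Literature.NumberTheory.LFunctions.Zhang2022.Section8FrontEnd810
import Literature.NumberTheory.LFunctions.Zhang2022.Section9Statements
import HarnessLib

/-!
# Zhang (2022) §9 p. 51: the EXACT form of `S_j(𝐚₁₂,𝐚₂₂)` behind "in a way similar to the proof of
# (8.12)" (`Z22:§9.u004`) — the algebraic half of the §9 gathering, kernel-checked

Y. Zhang, *Discrete mean estimates and the Landau–Siegel zero*, arXiv:2211.02515v1 (2022)
[Zhang2022LandauSiegel] — **an unrefereed manuscript under adjudication**; D-0069 campaign, cell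
`siegel-zhang`, discharge seat d17, cone leaf C23 (`Skeleton.Ded97`), node `Z22:§9.u004` (typed as
`Section9Statements.Ded9u004 : Step9u001 → Step9u002 → Step9u003 → Lemma82 → Lemma84 → Step9u004r`).

This is the §9 twin of d20's `Section8FrontEnd44Exact.Sj_a11_a21_eq` (which treats `S_j(𝐚₁₁,𝐚₂₁)`):
for a quadratic `χ`, `P₃ ≤ P₂ ≤ P₁ ≤ PT⁻²`,

`S_j(𝐚₁₂,𝐚₂₂) = Σ_{n<P₃} Σ_{dr=n} w_j(d,r)·(ῑ₃M₃ + ῑ₄M₂)(ι₃N₃ + ι₄N₂) + Σ_{P₃≤n<P₂} Σ_{dr=n} w_j(d,r)·(ῑ₄M₂)(ι₄N₂)`,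

`w_j(d,r) = |μ(r)||χ(dr)|λ₀ⱼ(dr)/(drφ(r))`, with `M₃ = Σ_m χ(m)ϰ₃(drm)m^{−(1−β_j)}` and
`N₃ = Σ_n χ(n)ϰ̄₃(drn)ξ₀ⱼ(n;d,r)/n` the sums of `Z22:§9.u002/u003`, and `M₂, N₂` the `ϰ₂`-sums of
`Z22:§8.u041/u043` (the SAME sums as in §8). So the "similar" passage of §9 reduces, in the kernel, to
replacing `M₂, M₃, N₂, N₃` by their main terms with total error `o(α)` (Lemmas 8.2/8.4 for `dr < P_k/T`,
d37's `xiZeroTailMean` on `P_k/T ≤ dr < P_k`), then (8.10), `λ₀ⱼ(n) = φ(n)²/n² + O(α₁)`, the mean value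
of `|χ(n)|φ(n)/n²` and partial summation — exactly the §8 chain `Z22:§8.u044 → u046 → (8.11)` at scales
`(P₂, P₃)` and coefficients `(ῑ₄, ῑ₃; ι₄, ι₃)`.

Also recorded (pure glue, kernel-checked): `substituted_of_gathered` — the substitution `n = dr` via
(8.10) (`Section8FrontEnd810.sum_antidiagonal_weight`, `eq810_holds`) turns the "gathered" form (main terms
inserted, weights `w_j(d,r)Π(d,r)`) into the single-sum form with weights `|χ(n)|λ₀ⱼ(n)/φ(n)`; and
`step9u004r_of_parts` — `Step9u004r` follows from exactly TWO analytic sub-claims stated there as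
hypotheses: (G9) the gathering with total error `o(α)` (the §9 twin of `Z22:§8.u044`/`DedStep8u044`) and
(PS9) the partial summation turning `L′(1,χ)²Σ_n |χ(n)|λ₀ⱼ(n)/φ(n)·Φ(n)` into `𝔞∫Φ(x)dx/x + o(α)` (the §9
twin of `Z22:(8.11)`/`Ded811`). These two are what remains of `Ded9u004`.

Theorem-only; no definition, no new fact. WHAT THIS IS NOT: a proof of `Step9u004r`, or any claim about
the manuscript's Theorems 1–2 / Landau–Siegel zeros.

## References

* Y. Zhang, arXiv:2211.02515v1 (2022), §9 p. 51 (tex L2598–L2618), (8.6), (9.2), §7 Prop. 7.1 (`S_j`),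
  (7.2); §8 p. 47 (tex L2436). [cite: Zhang2022LandauSiegel, §9 p.51]
-/

noncomputable section

open Complex Real ComplexConjugate Finset

namespace Literature.NumberTheory.LFunctions.Zhang2022.Section9FrontEndExact

open Literature.NumberTheory.LFunctions.Zhang2022.Skeleton
open Literature.NumberTheory.LFunctions.Zhang2022.Section8FrontEnd44Exact

/-! ## Values of a quadratic character -/

/-- A quadratic character is real-valued: `conj χ(a) = χ(a)`. [folklore] -/
private theorem conj_apply_of_quadratic {D : ℕ} [NeZero D] {χ : DirichletCharacter ℂ D}
    (hq : χ.IsQuadratic) (a : ZMod D) : conj (χ a) = χ a := by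
  rcases hq a with h | h | h <;> simp [h]

/-- For a quadratic character, `χ(a)² = |χ(a)|` (values `0, ±1`). [folklore] -/
private theorem mul_self_apply_of_quadratic {D : ℕ} [NeZero D] {χ : DirichletCharacter ℂ D}
    (hq : χ.IsQuadratic) (a : ZMod D) : χ a * χ a = (‖χ a‖ : ℂ) := by
  rcases hq a with h | h | h <;> simp [h]

/-! ## (9.2) at `drm`: `𝐚₁₂(km) = χ(k)χ(m)(ῑ₃ϰ₃(km) + ῑ₄ϰ₂(km))`, `𝐚₂₂ = 𝐚̄₁₂` -/

/-- `𝐚₁₂(km) = χ(k)·χ(m)(ῑ₃ϰ₃(km) + ῑ₄ϰ₂(km))` ((9.2), `χ` multiplicative).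
[cite: Zhang2022LandauSiegel, §9 (9.2) p.51, tex L2594] -/
theorem a12_mul {D : ℕ} [NeZero D] (χ : DirichletCharacter ℂ D) (k m : ℕ) :
    a12 χ (k * m) =
      χ (k : ZMod D) * (χ (m : ZMod D) * (conj iota3 * vk3 D (k * m) + conj iota4 * vk2 D (k * m))) := by
  rw [a12, Nat.cast_mul, map_mul, mul_assoc]

/-- `𝐚₂₂(km) = χ(k)·χ(m)(ι₃ϰ̄₃(km) + ι₄ϰ̄₂(km))` for a quadratic `χ` ((9.2) in the used reading
`𝐚₂₂ = 𝐚̄₁₂`, banked `Skeleton.a22`; `χ̄ = χ`). [cite: Zhang2022LandauSiegel, §9 (9.2) p.51, tex L2594–L2601] -/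
theorem a22_mul {D : ℕ} [NeZero D] {χ : DirichletCharacter ℂ D} (hq : χ.IsQuadratic) (k m : ℕ) :
    a22 χ (k * m) = χ (k : ZMod D) *
      (χ (m : ZMod D) * (iota3 * conj (vk3 D (k * m)) + iota4 * conj (vk2 D (k * m)))) := by
  rw [a22, a12_mul, map_mul, map_mul, map_add, map_mul, map_mul, Complex.conj_conj, Complex.conj_conj,
    conj_apply_of_quadratic hq, conj_apply_of_quadratic hq]

/-! ## The inner sums of `S_j(𝐚₁₂,𝐚₂₂)` -/

/-- The `m`-sum of `S_j(𝐚₁₂,𝐚₂₂)` at `(d,r)` (`k = dr`): `Σ_m 𝐚₁₂(km)m^{−(1−β_j)} = χ(k)(ῑ₃M₃ + ῑ₄M₂)`.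
[cite: Zhang2022LandauSiegel, §9 p.51, tex L2598] -/
theorem msum_eq {D : ℕ} [NeZero D] (χ : DirichletCharacter ℂ D) (c' : ℝ) (j k : ℕ) :
    (∑ m ∈ Finset.Ico 1 (Nsupp D), a12 χ (k * m) / (m : ℂ) ^ (1 - betaJ c' D j)) =
      χ (k : ZMod D) *
        (conj iota3 * (∑ m ∈ Finset.Ico 1 (Nsupp D),
            χ (m : ZMod D) * vk3 D (k * m) / (m : ℂ) ^ (1 - betaJ c' D j)) +
          conj iota4 * ∑ m ∈ Finset.Ico 1 (Nsupp D),
            χ (m : ZMod D) * vk2 D (k * m) / (m : ℂ) ^ (1 - betaJ c' D j)) := by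
  rw [Finset.mul_sum, Finset.mul_sum, mul_add, Finset.mul_sum, Finset.mul_sum, ← Finset.sum_add_distrib]
  apply Finset.sum_congr rfl
  intro m _
  rw [a12_mul]
  ring

/-- The `n`-sum of `S_j(𝐚₁₂,𝐚₂₂)` at `(d,r)`: `Σ_n 𝐚₂₂(drn)ξ₀ⱼ(n;d,r)/n = χ(dr)(ι₃N₃ + ι₄N₂)`.
[cite: Zhang2022LandauSiegel, §9 p.51, tex L2600] -/
theorem nsum_eq {D : ℕ} [NeZero D] {χ : DirichletCharacter ℂ D} (hq : χ.IsQuadratic) (c' : ℝ)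
    (j d r : ℕ) :
    (∑ n ∈ Finset.Ico 1 (Nsupp D), a22 χ (d * r * n) * xiZero c' D j n d r / (n : ℂ)) =
      χ ((d * r : ℕ) : ZMod D) *
        (iota3 * (∑ n ∈ Finset.Ico 1 (Nsupp D),
            χ (n : ZMod D) * conj (vk3 D (d * r * n)) * xiZero c' D j n d r / (n : ℂ)) +
          iota4 * ∑ n ∈ Finset.Ico 1 (Nsupp D),
            χ (n : ZMod D) * conj (vk2 D (d * r * n)) * xiZero c' D j n d r / (n : ℂ)) := by
  rw [Finset.mul_sum, Finset.mul_sum, mul_add, Finset.mul_sum, Finset.mul_sum, ← Finset.sum_add_distrib]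
  apply Finset.sum_congr rfl
  intro n _
  rw [a22_mul hq]
  push_cast
  ring

/-! ## Support: `ϰ₃(drm) = 0` for `dr ≥ P₃` -/

/-- `ϰ₃(km) = 0` for `k ≥ P₃`, `m ≥ 1` ((8.6)). [cite: Zhang2022LandauSiegel, §8 (8.6) p.44] -/
theorem vk3_eq_zero_of_le {D k m : ℕ} (hk : Skeleton.P3 D ≤ k) (hm : 1 ≤ m) : vk3 D (k * m) = 0 := by
  have : Skeleton.P3 D ≤ ((k * m : ℕ) : ℝ) := by
    have h1 : (k : ℝ) ≤ ((k * m : ℕ) : ℝ) := by exact_mod_cast Nat.le_mul_of_pos_right k hm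
    linarith
  rw [vk3, if_neg (not_lt.mpr this)]

/-! ## Re-indexing the double sum over `(d, r)` by `n = dr` -/

/-- The pairs `(d,r)` with `1 ≤ d, r < N` and `dr < K ≤ N` are the factorisations of the `n`,
`1 ≤ n < K`. [folklore] -/
private theorem filter_product_eq_biUnion {N K : ℕ} (hKN : K ≤ N) :
    (Finset.Ico 1 N ×ˢ Finset.Ico 1 N).filter (fun p : ℕ × ℕ => p.1 * p.2 < K) =
      (Finset.Ico 1 K).biUnion Nat.divisorsAntidiagonal := by
  ext p
  simp only [Finset.mem_filter, Finset.mem_product, Finset.mem_Ico, Finset.mem_biUnion,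
    Nat.mem_divisorsAntidiagonal]
  constructor
  · rintro ⟨⟨⟨h1, -⟩, ⟨h2, -⟩⟩, hK⟩
    refine ⟨p.1 * p.2, ⟨Nat.one_le_iff_ne_zero.mpr (Nat.mul_ne_zero (by omega) (by omega)), hK⟩,
      rfl, Nat.mul_ne_zero (by omega) (by omega)⟩
  · rintro ⟨n, ⟨hn1, hnK⟩, hpn, hn0⟩
    have hp1 : p.1 ≠ 0 := fun h => hn0 (by rw [← hpn, h, zero_mul])
    have hp2 : p.2 ≠ 0 := fun h => hn0 (by rw [← hpn, h, mul_zero])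
    have h1 : p.1 ≤ n := by rw [← hpn]; exact Nat.le_mul_of_pos_right _ (Nat.pos_of_ne_zero hp2)
    have h2 : p.2 ≤ n := by rw [← hpn]; exact Nat.le_mul_of_pos_left _ (Nat.pos_of_ne_zero hp1)
    refine ⟨⟨⟨Nat.one_le_iff_ne_zero.mpr hp1, by omega⟩, ⟨Nat.one_le_iff_ne_zero.mpr hp2, by omega⟩⟩,
      by rw [hpn]; exact hnK⟩

/-- Distinct `n` have disjoint divisor antidiagonals. [folklore] -/
private theorem pairwiseDisjoint_divisorsAntidiagonal (s : Finset ℕ) :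
    (s : Set ℕ).PairwiseDisjoint Nat.divisorsAntidiagonal := by
  intro a _ b _ hab
  rw [Function.onFun, Finset.disjoint_left]
  intro p ha hb
  rw [Nat.mem_divisorsAntidiagonal] at ha hb
  exact hab (ha.1.symm.trans hb.1)

/-- Re-indexing: a double sum over `1 ≤ d, r < N` whose terms vanish for `dr ≥ K` (`K ≤ N`) is the
sum over `1 ≤ n < K` of the sums over the factorisations `n = dr`. [folklore] -/
private theorem sum_sum_eq_sum_antidiagonal {N K : ℕ} (hKN : K ≤ N) (f : ℕ → ℕ → ℂ)
    (hf : ∀ d r : ℕ, 1 ≤ d → 1 ≤ r → K ≤ d * r → f d r = 0) :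
    (∑ d ∈ Finset.Ico 1 N, ∑ r ∈ Finset.Ico 1 N, f d r) =
      ∑ n ∈ Finset.Ico 1 K, ∑ p ∈ Nat.divisorsAntidiagonal n, f p.1 p.2 := by
  rw [← Finset.sum_product', ← Finset.sum_biUnion (pairwiseDisjoint_divisorsAntidiagonal _),
    ← filter_product_eq_biUnion hKN, Finset.sum_filter]
  apply Finset.sum_congr rfl
  intro p hp
  rw [Finset.mem_product, Finset.mem_Ico, Finset.mem_Ico] at hp
  by_cases h : p.1 * p.2 < K
  · rw [if_pos h]
  · rw [if_neg h, hf p.1 p.2 hp.1.1 hp.2.1 (not_lt.mp h)]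

/-! ## The exact identity -/

/-- **The exact form of `S_j(𝐚₁₂,𝐚₂₂)` behind `Z22:§9.u004`**: for a quadratic `χ` and
`P₃ ≤ P₂ ≤ PT⁻²` (true for `𝓛 ≥ 4`):
`S_j(𝐚₁₂,𝐚₂₂) = Σ_{1≤n<⌈P₃⌉} Σ_{dr=n} w_j(d,r)(ῑ₃M₃+ῑ₄M₂)(ι₃N₃+ι₄N₂) + Σ_{⌈P₃⌉≤n<⌈P₂⌉} Σ_{dr=n} w_j(d,r)(ῑ₄M₂)(ι₄N₂)`
with `w_j(d,r) = |μ(r)||χ(dr)|λ₀ⱼ(dr)/(drφ(r))`, `M₃, N₃` the sums of `Z22:§9.u002/u003` and `M₂, N₂`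
those of `Z22:§8.u041/u043` at `(d,r)` — an IDENTITY (no error term).
[cite: Zhang2022LandauSiegel, §9 p.51, tex L2598–L2618] -/
theorem Sj_a12_a22_eq (c' : ℝ) {D : ℕ} [NeZero D] {χ : DirichletCharacter ℂ D}
    (hq : χ.IsQuadratic) (hP2 : Skeleton.P2 D ≤ bigP D / bigT D ^ 2)
    (hP32 : Skeleton.P3 D ≤ Skeleton.P2 D) (j : ℕ) :
    Sj c' D j (a12 χ) (a22 χ) =
      (∑ n ∈ Finset.Ico 1 ⌈Skeleton.P3 D⌉₊, ∑ p ∈ Nat.divisorsAntidiagonal n,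
        ((ArithmeticFunction.moebius p.2).natAbs : ℂ) * (‖χ ((p.1 * p.2 : ℕ) : ZMod D)‖ : ℂ) /
              (((p.1 * p.2 : ℕ) : ℂ) * (Nat.totient p.2 : ℂ)) * lamZero c' D j (p.1 * p.2) *
          ((conj iota3 * (∑ m ∈ Finset.Ico 1 (Nsupp D),
                χ (m : ZMod D) * vk3 D (p.1 * p.2 * m) / (m : ℂ) ^ (1 - betaJ c' D j)) +
              conj iota4 * ∑ m ∈ Finset.Ico 1 (Nsupp D),
                χ (m : ZMod D) * vk2 D (p.1 * p.2 * m) / (m : ℂ) ^ (1 - betaJ c' D j)) *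
            (iota3 * (∑ n ∈ Finset.Ico 1 (Nsupp D),
                χ (n : ZMod D) * conj (vk3 D (p.1 * p.2 * n)) * xiZero c' D j n p.1 p.2 / (n : ℂ)) +
              iota4 * ∑ n ∈ Finset.Ico 1 (Nsupp D),
                χ (n : ZMod D) * conj (vk2 D (p.1 * p.2 * n)) * xiZero c' D j n p.1 p.2 /
                  (n : ℂ)))) +
      ∑ n ∈ Finset.Ico ⌈Skeleton.P3 D⌉₊ ⌈Skeleton.P2 D⌉₊, ∑ p ∈ Nat.divisorsAntidiagonal n,
        ((ArithmeticFunction.moebius p.2).natAbs : ℂ) * (‖χ ((p.1 * p.2 : ℕ) : ZMod D)‖ : ℂ) /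
              (((p.1 * p.2 : ℕ) : ℂ) * (Nat.totient p.2 : ℂ)) * lamZero c' D j (p.1 * p.2) *
          ((conj iota4 * ∑ m ∈ Finset.Ico 1 (Nsupp D),
              χ (m : ZMod D) * vk2 D (p.1 * p.2 * m) / (m : ℂ) ^ (1 - betaJ c' D j)) *
            (iota4 * ∑ n ∈ Finset.Ico 1 (Nsupp D),
              χ (n : ZMod D) * conj (vk2 D (p.1 * p.2 * n)) * xiZero c' D j n p.1 p.2 / (n : ℂ))) := by
  -- abbreviations
  set N := Nsupp D with hN
  set M₃ : ℕ → ℕ → ℂ := fun d r => ∑ m ∈ Finset.Ico 1 N,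
    χ (m : ZMod D) * vk3 D (d * r * m) / (m : ℂ) ^ (1 - betaJ c' D j) with hM₃
  set M₂ : ℕ → ℕ → ℂ := fun d r => ∑ m ∈ Finset.Ico 1 N,
    χ (m : ZMod D) * vk2 D (d * r * m) / (m : ℂ) ^ (1 - betaJ c' D j) with hM₂
  set N₃ : ℕ → ℕ → ℂ := fun d r => ∑ n ∈ Finset.Ico 1 N,
    χ (n : ZMod D) * conj (vk3 D (d * r * n)) * xiZero c' D j n d r / (n : ℂ) with hN₃
  set N₂ : ℕ → ℕ → ℂ := fun d r => ∑ n ∈ Finset.Ico 1 N,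
    χ (n : ZMod D) * conj (vk2 D (d * r * n)) * xiZero c' D j n d r / (n : ℂ) with hN₂
  set w : ℕ → ℕ → ℂ := fun d r =>
    ((ArithmeticFunction.moebius r).natAbs : ℂ) * (‖χ ((d * r : ℕ) : ZMod D)‖ : ℂ) /
      (((d * r : ℕ) : ℂ) * (Nat.totient r : ℂ)) * lamZero c' D j (d * r) with hw
  -- Step 1: the (d,r)-term of `S_j` is `w(d,r)(ῑ₃M₃+ῑ₄M₂)(ι₃N₃+ι₄N₂)`
  have hterm : ∀ d r : ℕ,
      ((ArithmeticFunction.moebius r).natAbs : ℂ) * lamZero c' D j (d * r) /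
            ((d * r : ℕ) * (Nat.totient r : ℂ)) *
          (∑ m ∈ Finset.Ico 1 N, a12 χ (d * r * m) / (m : ℂ) ^ (1 - betaJ c' D j)) *
          (∑ n ∈ Finset.Ico 1 N, a22 χ (d * r * n) * xiZero c' D j n d r / (n : ℂ)) =
        w d r * ((conj iota3 * M₃ d r + conj iota4 * M₂ d r) * (iota3 * N₃ d r + iota4 * N₂ d r)) := by
    intro d r
    rw [hN, msum_eq χ c' j (d * r), nsum_eq hq c' j d r, ← hN]
    simp only [hw, hM₃, hM₂, hN₃, hN₂]
    have hsq := mul_self_apply_of_quadratic hq ((d * r : ℕ) : ZMod D)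
    rw [← hsq]
    ring
  -- Step 2: supports
  have hM₃0 : ∀ d r : ℕ, Skeleton.P3 D ≤ ((d * r : ℕ) : ℝ) → M₃ d r = 0 := by
    intro d r h
    simp only [hM₃]
    apply Finset.sum_eq_zero
    intro m hm
    rw [Finset.mem_Ico] at hm
    rw [vk3_eq_zero_of_le h hm.1, mul_zero, zero_div]
  have hM₂0 : ∀ d r : ℕ, Skeleton.P2 D ≤ ((d * r : ℕ) : ℝ) → M₂ d r = 0 := by
    intro d r h
    simp only [hM₂]
    apply Finset.sum_eq_zero
    intro m hm
    rw [Finset.mem_Ico] at hm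
    rw [vk2_eq_zero_of_le h hm.1, mul_zero, zero_div]
  have hN₃0 : ∀ d r : ℕ, Skeleton.P3 D ≤ ((d * r : ℕ) : ℝ) → N₃ d r = 0 := by
    intro d r h
    simp only [hN₃]
    apply Finset.sum_eq_zero
    intro n hn
    rw [Finset.mem_Ico] at hn
    rw [vk3_eq_zero_of_le h hn.1, map_zero, mul_zero, zero_mul, zero_div]
  -- Step 3: re-index by `n = dr` over `n < ⌈P₂⌉`
  have hK : ⌈Skeleton.P2 D⌉₊ ≤ N := by rw [hN, Nsupp]; exact Nat.ceil_mono hP2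
  have step3 : Sj c' D j (a12 χ) (a22 χ) =
      ∑ n ∈ Finset.Ico 1 ⌈Skeleton.P2 D⌉₊, ∑ p ∈ Nat.divisorsAntidiagonal n,
        w p.1 p.2 * ((conj iota3 * M₃ p.1 p.2 + conj iota4 * M₂ p.1 p.2) *
          (iota3 * N₃ p.1 p.2 + iota4 * N₂ p.1 p.2)) := by
    rw [Sj, ← hN]
    rw [← sum_sum_eq_sum_antidiagonal hK (fun d r =>
        w d r * ((conj iota3 * M₃ d r + conj iota4 * M₂ d r) * (iota3 * N₃ d r + iota4 * N₂ d r)))]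
    · apply Finset.sum_congr rfl
      intro d _
      apply Finset.sum_congr rfl
      intro r _
      exact hterm d r
    · intro d r _ _ hK'
      have h2 : Skeleton.P2 D ≤ ((d * r : ℕ) : ℝ) := le_trans (Nat.le_ceil _) (by exact_mod_cast hK')
      have h3 : Skeleton.P3 D ≤ ((d * r : ℕ) : ℝ) := le_trans hP32 h2
      rw [hM₃0 d r h3, hM₂0 d r h2, mul_zero, mul_zero, zero_add, zero_mul, mul_zero]
  -- Step 4: split the range at `⌈P₃⌉` and drop `M₃, N₃` on the upper part
  have hsplit : ⌈Skeleton.P3 D⌉₊ ≤ ⌈Skeleton.P2 D⌉₊ := Nat.ceil_mono hP32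
  have hP3pos : 0 < Skeleton.P3 D := Real.rpow_pos_of_pos (Real.exp_pos _) _
  have h1le : 1 ≤ ⌈Skeleton.P3 D⌉₊ := Nat.one_le_iff_ne_zero.mpr (Nat.ceil_pos.mpr hP3pos).ne'
  rw [step3, ← Finset.sum_Ico_consecutive _ h1le hsplit]
  congr 1
  apply Finset.sum_congr rfl
  intro n hn
  rw [Finset.mem_Ico] at hn
  apply Finset.sum_congr rfl
  intro p hp
  rw [Nat.mem_divisorsAntidiagonal] at hp
  have h3 : Skeleton.P3 D ≤ ((p.1 * p.2 : ℕ) : ℝ) := by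
    rw [hp.1]; exact le_trans (Nat.le_ceil _) (by exact_mod_cast hn.1)
  rw [hM₃0 p.1 p.2 h3, hN₃0 p.1 p.2 h3, mul_zero, zero_add, mul_zero, zero_add]

/-- For `𝓛 ≥ 4` the scale hypotheses of `Sj_a12_a22_eq` hold: `P₃ ≤ P₂ ≤ PT⁻²`
(`P₂/P₃ = P^{0.002}T^{−10} ≥ 1` since `10𝓛^{1.1} ≤ 0.002𝓛⁹`; `P₂ ≤ P₁ ≤ PT⁻²`).
[cite: Zhang2022LandauSiegel, §2 (2.21)] -/
theorem scales_ok {D : ℕ} (h : 4 ≤ ell D) :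
    Skeleton.P2 D ≤ bigP D / bigT D ^ 2 ∧ Skeleton.P3 D ≤ Skeleton.P2 D := by
  have hℓ2 : 2 ≤ Real.log D := by rw [← ell]; linarith
  have h1 : 1 ≤ ell D := by linarith
  refine ⟨(P2_le_P1 D).trans (P1_le_P_div_T_sq D hℓ2), ?_⟩
  -- `P₃ ≤ P₂` iff `T¹⁰ ≤ P^{0.002}`, i.e. `10𝓛^{1.1} ≤ 0.002𝓛⁹`
  have hP : 0 < bigP D := Real.exp_pos _
  have hT : 0 < bigT D := Real.exp_pos _
  rw [Skeleton.P2, Skeleton.P3, le_div_iff₀ (pow_pos hT _)]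
  have e1 : bigP D ^ (0.498 : ℝ) * bigT D ^ 10 = Real.exp (0.498 * ell D ^ 9 + 10 * ell D ^ (1.1 : ℝ)) := by
    rw [bigP, bigT, ← Real.exp_mul, ← Real.exp_nat_mul, ← Real.exp_add]; push_cast; ring_nf
  have e2 : bigP D ^ (0.5 : ℝ) = Real.exp (0.5 * ell D ^ 9) := by
    rw [bigP, ← Real.exp_mul]; ring_nf
  rw [e1, e2, Real.exp_le_exp]
  have h2 : ell D ^ (1.1 : ℝ) ≤ ell D ^ 2 := by
    have := Real.rpow_le_rpow_of_exponent_le h1 (by norm_num : (1.1 : ℝ) ≤ 2)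
    rwa [Real.rpow_two] at this
  have h7 : (4:ℝ) ^ 7 ≤ ell D ^ 7 := pow_le_pow_left₀ (by norm_num) h 7
  have h3 : 10 * ell D ^ 2 ≤ 0.002 * ell D ^ 9 := by
    rw [show ell D ^ 9 = ell D ^ 2 * ell D ^ 7 by ring]
    nlinarith [pow_nonneg (by linarith : (0:ℝ) ≤ ell D) 2]
  linarith


/-! ## Glue: (8.10)-substitution and the reduction of `Step9u004r` to two analytic sub-claims -/

section Glue

variable (c' : ℝ)

/-- **The substitution `n = dr` for §9** (twin of `Z22:§8.u046`): if `S_j(𝐚₁₂,𝐚₂₂)` is within `o(α)` of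
the "gathered" two-range form with weights `|μ(r)||χ(dr)|λ₀ⱼ(dr)Π(d,r)/(drφ(r))` and ARBITRARY profiles
`Φ, Ψ` of `n = dr`, then it is within the same `o(α)` of the single-sum form with weights
`|χ(n)|λ₀ⱼ(n)/φ(n)` — by (8.10) (`eq810_holds`) under each `Σ_n` (`sum_antidiagonal_weight`).
[cite: Zhang2022LandauSiegel, §9 p.51 «in a way similar to the proof of (8.12)»; §8 (8.10) p.48, tex L2443–L2456] -/
theorem substituted_of_gathered (Φ Ψ : (D : ℕ) → DirichletCharacter ℂ D → ℕ → ℕ → ℂ)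
    (hG : ∀ ε : ℝ, 0 < ε → ForAllLarge fun D _ χ => AssumptionA D χ →
      ∀ j ∈ ({1, 2, 3} : Finset ℕ),
        ‖Sj c' D j (a12 χ) (a22 χ) -
            (deriv χ.LFunction 1 ^ 2 *
                (∑ n ∈ Finset.Ico 1 ⌈Skeleton.P3 D⌉₊, ∑ p ∈ Nat.divisorsAntidiagonal n,
                  ((ArithmeticFunction.moebius p.2).natAbs : ℂ) *
                        (‖χ ((p.1 * p.2 : ℕ) : ZMod D)‖ : ℂ) /
                      (((p.1 * p.2 : ℕ) : ℂ) * (Nat.totient p.2 : ℂ)) *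
                    lamZero c' D j (p.1 * p.2) * PiW χ p.1 p.2 * Φ D χ j n) +
              deriv χ.LFunction 1 ^ 2 *
                (∑ n ∈ Finset.Ico ⌈Skeleton.P3 D⌉₊ ⌈Skeleton.P2 D⌉₊, ∑ p ∈ Nat.divisorsAntidiagonal n,
                  ((ArithmeticFunction.moebius p.2).natAbs : ℂ) *
                        (‖χ ((p.1 * p.2 : ℕ) : ZMod D)‖ : ℂ) /
                      (((p.1 * p.2 : ℕ) : ℂ) * (Nat.totient p.2 : ℂ)) *
                    lamZero c' D j (p.1 * p.2) * PiW χ p.1 p.2 * Ψ D χ j n))‖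
          ≤ ε * alpha D) :
    ∀ ε : ℝ, 0 < ε → ForAllLarge fun D _ χ => AssumptionA D χ →
      ∀ j ∈ ({1, 2, 3} : Finset ℕ),
        ‖Sj c' D j (a12 χ) (a22 χ) -
            (deriv χ.LFunction 1 ^ 2 *
                (∑ n ∈ Finset.Ico 1 ⌈Skeleton.P3 D⌉₊,
                  (‖χ (n : ZMod D)‖ : ℂ) * lamZero c' D j n / (Nat.totient n : ℂ) * Φ D χ j n) +
              deriv χ.LFunction 1 ^ 2 *
                (∑ n ∈ Finset.Ico ⌈Skeleton.P3 D⌉₊ ⌈Skeleton.P2 D⌉₊,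
                  (‖χ (n : ZMod D)‖ : ℂ) * lamZero c' D j n / (Nat.totient n : ℂ) * Ψ D χ j n))‖
          ≤ ε * alpha D := by
  intro ε hε
  refine (hG ε hε).mono ?_
  intro D _ χ hq _ h hA j hj
  have key := h hA j hj
  have hP3 : 0 < Skeleton.P3 D := Real.rpow_pos_of_pos (Real.exp_pos _) _
  have h1 : ∀ n ∈ Finset.Ico 1 ⌈Skeleton.P3 D⌉₊, n ≠ 0 := fun n hn => by
    rw [Finset.mem_Ico] at hn; omega
  have h2 : ∀ n ∈ Finset.Ico ⌈Skeleton.P3 D⌉₊ ⌈Skeleton.P2 D⌉₊, n ≠ 0 := fun n hn => by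
    rw [Finset.mem_Ico] at hn
    have : 0 < ⌈Skeleton.P3 D⌉₊ := Nat.ceil_pos.mpr hP3
    omega
  have h810 := Section8FrontEnd810.eq810_holds D χ hq
  rw [Finset.sum_congr rfl (fun n hn =>
      Section8FrontEnd810.sum_antidiagonal_weight χ c' j h810 (h1 n hn) (Φ D χ j n)),
    Finset.sum_congr rfl (fun n hn =>
      Section8FrontEnd810.sum_antidiagonal_weight χ c' j h810 (h2 n hn) (Ψ D χ j n))] at key
  exact key

/-- **`Step9u004r` from its two analytic halves.** With the §9 profiles
`Φ(n) = (ῑ₃𝔣_{j6}(P₃/n)/log P₃ + ῑ₄𝔣_{j7}(P₂/n)/log P₂)(ι₃𝔤_{j6}(P₃/n)/log P₃ + ι₄𝔤_{j7}(P₂/n)/log P₂)`,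
`Ψ(n) = ῑ₄ι₄·𝔣_{j7}(P₂/n)𝔤_{j7}(P₂/n)/(log P₂)²`:
(G9) "gathering": `S_j(𝐚₁₂,𝐚₂₂) = L′(1,χ)²[Σ_{n<P₃}Σ_{dr=n} wΠ·Φ + Σ_{P₃≤n<P₂}Σ_{dr=n} wΠ·Ψ] + o(α)`
  (twin of `Z22:§8.u044`: Lemmas 8.2/8.4 for `dr < P_k/T` — `step9u002_sharp`/`step9u003_sharp`,
  `Step8u041/u043` —, `xiZeroTailMean` on `P_k/T ≤ dr < P_k`, via `Sj_a12_a22_eq`);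
(PS9) "partial integration": `L′(1,χ)²[Σ_{n<P₃}|χ(n)|λ₀ⱼ(n)/φ(n)Φ(n) + Σ_{P₃≤n<P₂}…Ψ(n)]
  = 𝔞(∫₁^{P₃}Φ(x)dx/x + |ι₄|²(log P₂)⁻²∫_{P₃}^{P₂}𝔣_{j7}𝔤_{j7}(P₂/x)dx/x) + o(α)`
  (twin of `Z22:(8.11)`: `λ₀ⱼ(n) = φ(n)²/n² + O(α₁)` `Step8u047`, the mean value of `|χ(n)|φ(n)/n²`
  `Step8u048`, Abel summation);
then `Step9u004r c'`. Pure bookkeeping (`substituted_of_gathered` + triangle inequality); (G9), (PS9) are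
the remaining content of `Ded9u004`. [cite: Zhang2022LandauSiegel, §9 p.51, tex L2613–L2618; §8 pp.47–48] -/
theorem step9u004r_of_parts
    (hG : ∀ ε : ℝ, 0 < ε → ForAllLarge fun D _ χ => AssumptionA D χ →
      ∀ j ∈ ({1, 2, 3} : Finset ℕ),
        ‖Sj c' D j (a12 χ) (a22 χ) -
            (deriv χ.LFunction 1 ^ 2 *
                (∑ n ∈ Finset.Ico 1 ⌈Skeleton.P3 D⌉₊, ∑ p ∈ Nat.divisorsAntidiagonal n,
                  ((ArithmeticFunction.moebius p.2).natAbs : ℂ) *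
                        (‖χ ((p.1 * p.2 : ℕ) : ZMod D)‖ : ℂ) /
                      (((p.1 * p.2 : ℕ) : ℂ) * (Nat.totient p.2 : ℂ)) *
                    lamZero c' D j (p.1 * p.2) * PiW χ p.1 p.2 *
                    ((conj iota3 * frakfW c' D j 6 (Skeleton.P3 D / n) / (Real.log (Skeleton.P3 D) : ℂ) +
                        conj iota4 * frakfW c' D j 7 (Skeleton.P2 D / n) / (Real.log (Skeleton.P2 D) : ℂ)) *
                      (iota3 * frakgW c' D j 6 (Skeleton.P3 D / n) / (Real.log (Skeleton.P3 D) : ℂ) +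
                        iota4 * frakgW c' D j 7 (Skeleton.P2 D / n) / (Real.log (Skeleton.P2 D) : ℂ)))) +
              deriv χ.LFunction 1 ^ 2 *
                (∑ n ∈ Finset.Ico ⌈Skeleton.P3 D⌉₊ ⌈Skeleton.P2 D⌉₊, ∑ p ∈ Nat.divisorsAntidiagonal n,
                  ((ArithmeticFunction.moebius p.2).natAbs : ℂ) *
                        (‖χ ((p.1 * p.2 : ℕ) : ZMod D)‖ : ℂ) /
                      (((p.1 * p.2 : ℕ) : ℂ) * (Nat.totient p.2 : ℂ)) *
                    lamZero c' D j (p.1 * p.2) * PiW χ p.1 p.2 *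
                    (conj iota4 * frakfW c' D j 7 (Skeleton.P2 D / n) / (Real.log (Skeleton.P2 D) : ℂ) *
                      (iota4 * frakgW c' D j 7 (Skeleton.P2 D / n) / (Real.log (Skeleton.P2 D) : ℂ)))))‖
          ≤ ε * alpha D)
    (hPS : ∀ ε : ℝ, 0 < ε → ForAllLarge fun D _ χ => AssumptionA D χ →
      ∀ j ∈ ({1, 2, 3} : Finset ℕ),
        ‖(deriv χ.LFunction 1 ^ 2 *
                (∑ n ∈ Finset.Ico 1 ⌈Skeleton.P3 D⌉₊,
                  (‖χ (n : ZMod D)‖ : ℂ) * lamZero c' D j n / (Nat.totient n : ℂ) *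
                    ((conj iota3 * frakfW c' D j 6 (Skeleton.P3 D / n) / (Real.log (Skeleton.P3 D) : ℂ) +
                        conj iota4 * frakfW c' D j 7 (Skeleton.P2 D / n) / (Real.log (Skeleton.P2 D) : ℂ)) *
                      (iota3 * frakgW c' D j 6 (Skeleton.P3 D / n) / (Real.log (Skeleton.P3 D) : ℂ) +
                        iota4 * frakgW c' D j 7 (Skeleton.P2 D / n) / (Real.log (Skeleton.P2 D) : ℂ)))) +
              deriv χ.LFunction 1 ^ 2 *
                (∑ n ∈ Finset.Ico ⌈Skeleton.P3 D⌉₊ ⌈Skeleton.P2 D⌉₊,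
                  (‖χ (n : ZMod D)‖ : ℂ) * lamZero c' D j n / (Nat.totient n : ℂ) *
                    (conj iota4 * frakfW c' D j 7 (Skeleton.P2 D / n) / (Real.log (Skeleton.P2 D) : ℂ) *
                      (iota4 * frakgW c' D j 7 (Skeleton.P2 D / n) / (Real.log (Skeleton.P2 D) : ℂ))))) -
            (frakA χ : ℂ) * (Section9Statements.int9main c' D j +
              (Complex.normSq iota4 : ℂ) * Section9Statements.int9tail c' D j)‖ ≤ ε * alpha D) :
    Section9Statements.Step9u004r c' := by
  intro ε hε
  have hS := substituted_of_gathered c'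
    (fun D χ j n =>
      (conj iota3 * frakfW c' D j 6 (Skeleton.P3 D / n) / (Real.log (Skeleton.P3 D) : ℂ) +
          conj iota4 * frakfW c' D j 7 (Skeleton.P2 D / n) / (Real.log (Skeleton.P2 D) : ℂ)) *
        (iota3 * frakgW c' D j 6 (Skeleton.P3 D / n) / (Real.log (Skeleton.P3 D) : ℂ) +
          iota4 * frakgW c' D j 7 (Skeleton.P2 D / n) / (Real.log (Skeleton.P2 D) : ℂ)))
    (fun D χ j n =>
      conj iota4 * frakfW c' D j 7 (Skeleton.P2 D / n) / (Real.log (Skeleton.P2 D) : ℂ) *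
        (iota4 * frakgW c' D j 7 (Skeleton.P2 D / n) / (Real.log (Skeleton.P2 D) : ℂ)))
    hG (ε / 2) (by positivity)
  refine (hS.and (hPS (ε / 2) (by positivity))).mono ?_
  intro D _ χ _ _ ⟨h1, h2⟩ hA j hj
  have e1 := h1 hA j hj
  have e2 := h2 hA j hj
  calc _ = ‖(Sj c' D j (a12 χ) (a22 χ) - _) + (_ - (frakA χ : ℂ) *
        (Section9Statements.int9main c' D j +
          (Complex.normSq iota4 : ℂ) * Section9Statements.int9tail c' D j))‖ := by
        congr 1; ring
    _ ≤ _ := norm_add_le _ _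
    _ ≤ ε / 2 * alpha D + ε / 2 * alpha D := add_le_add e1 e2
    _ = ε * alpha D := by ring

end Glue

end Literature.NumberTheory.LFunctions.Zhang2022.Section9FrontEndExact
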